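import Mathlib.Analysis.SpecialFunctions.Trigonometric.Deriv
import Literature.Analysis.FluidPDE.AncientSimilarityVariables
import Literature.Analysis.FluidPDE.IsometryInvariance
import Literature.Analysis.FluidPDE.SwirlTransportProofs
import Literature.Analysis.FluidPDE.SpaceTimeCalculus

/-!
# The co-rotating frame dictionary for Leray's backward system

Stub `stub_corotatingFrame` of the birth line of the crux `CorkscrewDynamo.CorkscrewProfile`:
for the rotation family about `e₃` pinned by coordinates, an angular velocity `ω` and a smooth
divergence-free pair `(V, Q)` solving the steady backward Leray system in the frame rotating with
angular velocity `ω`,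
`ω (e₃ × V − DV·(e₃ × y)) + ½ V + ½ (y·∇)V + (V·∇)V + ∇Q = ΔV`,
the uniformly rotating pair `U(s, y) = R_{ωs} V(R_{−ωs} y)`, `P(s, y) = Q(R_{−ωs} y)` is a classical
solution of the backward Leray system `∂ₛU + ½U + ½(y·∇)U + (U·∇)U + ∇P = ΔU`, `div U = 0` on all
of `ℝ × ℝ³`. The proof is the classical dictionary: joint smoothness from Rodrigues' formula
`R_φ w = w + sin φ • Jw + (1 − cos φ) • J(Jw)` (`J = e₃ × ·`), the time derivative
`∂ₛ R_{ωs} = ω J ∘ R_{ωs}`, and covariance of `(y·∇)`, `(U·∇)U`, `∇`, `Δ`, `div` under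
conjugation by a linear isometry (`Literature.Analysis.FluidPDE.IsometryInvariance`).
-/

noncomputable section

open Set Function WithLp Literature.Analysis.FluidPDE
open scoped Laplacian

namespace Summit.NavierStokesRegularity.NavierStokesRegularity.Theorems.CorkscrewProfile.Birth

set_option linter.dupNamespace false

/-- `e₃ × v` is the rotation generator `J v = (−v₁, v₀, 0)`. -/
theorem cross_single_two_eq_rotGen (v : (EuclideanSpace ℝ (Fin 3))) :
    cross (EuclideanSpace.single (2 : Fin 3) (1 : ℝ)) v = rotGen v := by
  ext i
  fin_cases i <;> simp [cross, rotGen, crossProduct]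

/-- Rodrigues' formula for the rotation about `e₃`:
`R_φ w = w + sin φ • Jw + (1 − cos φ) • J(Jw)`. -/
theorem rotZ_eq_rodrigues (φ : ℝ) (w : (EuclideanSpace ℝ (Fin 3))) :
    rotZ φ w = w + Real.sin φ • rotGen w + (1 - Real.cos φ) • rotGen (rotGen w) := by
  ext i
  fin_cases i <;> simp [rotGen] <;> ring

/-- Chain rule for a moving rotation applied to a moving vector:
`d/dt [R_{θ(t)} w(t)] = R_{θ} w' + θ' • J (R_{θ} w)`. -/
theorem hasDerivAt_rotZ_comp {θ : ℝ → ℝ} {θ' : ℝ} {w : ℝ → (EuclideanSpace ℝ (Fin 3))} {w' : (EuclideanSpace ℝ (Fin 3))} {s : ℝ}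
    (hθ : HasDerivAt θ θ' s) (hw : HasDerivAt w w' s) :
    HasDerivAt (fun t => rotZ (θ t) (w t)) (rotZ (θ s) w' + θ' • rotGen (rotZ (θ s) (w s))) s := by
  have e : (fun t => rotZ (θ t) (w t)) = fun t =>
      w t + Real.sin (θ t) • rotGenL (w t) + (1 - Real.cos (θ t)) • rotGenL (rotGenL (w t)) := by
    funext t
    simp only [rotGenL_apply]
    exact rotZ_eq_rodrigues (θ t) (w t)
  rw [e]
  have hJ : HasDerivAt (fun t => rotGenL (w t)) (rotGenL w') s :=
    rotGenL.hasFDerivAt.comp_hasDerivAt s hw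
  have hJJ : HasDerivAt (fun t => rotGenL (rotGenL (w t))) (rotGenL (rotGenL w')) s :=
    rotGenL.hasFDerivAt.comp_hasDerivAt s hJ
  have hs : HasDerivAt (fun t => Real.sin (θ t)) (Real.cos (θ s) * θ') s := hθ.sin
  have hc : HasDerivAt (fun t => 1 - Real.cos (θ t)) (-(-Real.sin (θ s) * θ')) s :=
    hθ.cos.const_sub 1
  have h := (hw.add (hs.smul hJ)).add (hc.smul hJJ)
  refine h.congr_deriv ?_
  simp only [rotGenL_apply]
  ext i
  fin_cases i <;> simp [rotGen] <;> ring

/-- Smoothness of a moving rotation applied to a moving vector: if `f` and `g` are `C^n` then so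
is `x ↦ R_{f(x)} (g x)` (Rodrigues' formula). -/
theorem contDiff_rotZ_comp {X : Type*} [NormedAddCommGroup X] [NormedSpace ℝ X] {n : WithTop ℕ∞}
    {f : X → ℝ} {g : X → (EuclideanSpace ℝ (Fin 3))} (hf : ContDiff ℝ n f) (hg : ContDiff ℝ n g) :
    ContDiff ℝ n (fun x => rotZ (f x) (g x)) := by
  have h : (fun x => rotZ (f x) (g x)) = fun x =>
      g x + Real.sin (f x) • rotGenL (g x) + (1 - Real.cos (f x)) • rotGenL (rotGenL (g x)) := by
    funext x
    simp only [rotGenL_apply]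
    exact rotZ_eq_rodrigues (f x) (g x)
  rw [h]
  exact (hg.add ((Real.contDiff_sin.comp hf).smul (rotGenL.contDiff.comp hg))).add
    ((contDiff_const.sub (Real.contDiff_cos.comp hf)).smul
      (rotGenL.contDiff.comp (rotGenL.contDiff.comp hg)))

/-- The regrouping identity behind `∂ₛ U = ω R (J V − DV·J)`:
`R_φ ((−ω) • D) + ω • J (R_φ A) = R_φ (ω • (J A − D))`. -/
theorem rotZ_neg_smul_add_smul_rotGen (φ ω : ℝ) (A D : (EuclideanSpace ℝ (Fin 3))) :
    rotZ φ ((-ω) • D) + ω • rotGen (rotZ φ A) = rotZ φ (ω • (rotGen A - D)) := by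
  ext i
  fin_cases i <;> simp [rotGen] <;> ring

/-- A rotation family about `e₃` pinned by coordinates IS `rotZ`, pointwise. -/
theorem rot_eq_rotZ (Rot : ℝ → ((EuclideanSpace ℝ (Fin 3)) ≃ₗᵢ[ℝ] (EuclideanSpace ℝ (Fin 3))))
    (hRot : ∀ (φ : ℝ) (x : (EuclideanSpace ℝ (Fin 3))), Rot φ x 0 = Real.cos φ * x 0 - Real.sin φ * x 1 ∧
        Rot φ x 1 = Real.sin φ * x 0 + Real.cos φ * x 1 ∧ Rot φ x 2 = x 2) (φ : ℝ) (x : (EuclideanSpace ℝ (Fin 3))) :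
    Rot φ x = rotZ φ x := by
  obtain ⟨h0, h1, h2⟩ := hRot φ x
  ext i
  fin_cases i
  · simpa using h0
  · simpa using h1
  · simpa using h2

/-- `R_a⁻¹ = R_{−a}` for a rotation family pinned by coordinates. -/
theorem rot_symm_apply_eq (Rot : ℝ → ((EuclideanSpace ℝ (Fin 3)) ≃ₗᵢ[ℝ] (EuclideanSpace ℝ (Fin 3))))
    (hRot : ∀ (φ : ℝ) (x : (EuclideanSpace ℝ (Fin 3))), Rot φ x 0 = Real.cos φ * x 0 - Real.sin φ * x 1 ∧
        Rot φ x 1 = Real.sin φ * x 0 + Real.cos φ * x 1 ∧ Rot φ x 2 = x 2) (a : ℝ) (x : (EuclideanSpace ℝ (Fin 3))) :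
    (Rot a).symm x = Rot (-a) x := by
  apply (Rot a).injective
  rw [LinearIsometryEquiv.apply_symm_apply, rot_eq_rotZ Rot hRot, rot_eq_rotZ Rot hRot, ← rotZ_add,
    add_neg_cancel, rotZ_zero]

/-- **The co-rotating frame dictionary** (stub `stub_corotatingFrame` of the birth line of
`CorkscrewDynamo.CorkscrewProfile`). For the rotation family about `e₃` pinned by coordinates, any
angular velocity `ω` and any smooth divergence-free `(V, Q)` solving the steady backward Leray
system in the frame rotating with angular velocity `ω`,
`ω (e₃ × V − DV·(e₃ × y)) + ½V + ½(y·∇)V + (V·∇)V + ∇Q = ΔV`, the uniformly rotating pair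
`U(s, y) = R_{ωs} V(R_{−ωs} y)`, `P(s, y) = Q(R_{−ωs} y)` is a classical solution of the backward
Leray system `∂ₛU + ½U + ½(y·∇)U + (U·∇)U + ∇P = ΔU`, `div U = 0` on all of `ℝ × ℝ³`. -/
theorem stub_corotatingFrame :
    ∀ (Rot : ℝ → (EuclideanSpace ℝ (Fin 3) ≃ₗᵢ[ℝ] EuclideanSpace ℝ (Fin 3))) (ω : ℝ)
      (V : EuclideanSpace ℝ (Fin 3) → EuclideanSpace ℝ (Fin 3)) (Q : EuclideanSpace ℝ (Fin 3) → ℝ),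
      (∀ (φ : ℝ) (x : EuclideanSpace ℝ (Fin 3)),
          Rot φ x 0 = Real.cos φ * x 0 - Real.sin φ * x 1 ∧
          Rot φ x 1 = Real.sin φ * x 0 + Real.cos φ * x 1 ∧ Rot φ x 2 = x 2) →
      ContDiff ℝ (⊤ : ℕ∞) V → ContDiff ℝ (⊤ : ℕ∞) Q →
      Literature.Analysis.FluidPDE.VectorCalculus.IsDivFree V →
      (∀ y : EuclideanSpace ℝ (Fin 3),
          ω • (Literature.Analysis.FluidPDE.cross (EuclideanSpace.single (2 : Fin 3) (1 : ℝ)) (V y)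
                - fderiv ℝ V y (Literature.Analysis.FluidPDE.cross (EuclideanSpace.single (2 : Fin 3) (1 : ℝ)) y))
            + (1 / 2 : ℝ) • V y + (1 / 2 : ℝ) • fderiv ℝ V y y
            + Literature.Analysis.FluidPDE.convect V V y + gradient Q y
            = Laplacian.laplacian V y) →
      Literature.Analysis.FluidPDE.IsBackwardLeraySolutionOn Set.univ 1
        (fun s y => Rot (ω * s) (V (Rot (-(ω * s)) y))) (fun s y => Q (Rot (-(ω * s)) y)) := by
  intro Rot ω V Q hRot hV hQ hdiv hEq
  have hR : ∀ φ x, Rot φ x = rotZ φ x := rot_eq_rotZ Rot hRot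
  have hsymm : ∀ a x, (Rot a).symm x = Rot (-a) x := rot_symm_apply_eq Rot hRot
  have hVd : Differentiable ℝ V := hV.differentiable (by simp)
  -- the slices are conjugations by the linear isometry `Rot (ω s)`
  have hUfun : ∀ s : ℝ, (fun y => Rot (ω * s) (V (Rot (-(ω * s)) y))) =
      fun y => Rot (ω * s) (V ((Rot (ω * s)).symm y)) := fun s => by
    funext y
    rw [hsymm]
  have hPfun : ∀ s : ℝ, (fun y => Q (Rot (-(ω * s)) y)) = fun y => Q ((Rot (ω * s)).symm y) :=
    fun s => by
    funext y
    rw [hsymm]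
  -- joint smoothness
  have h2 : ContDiff ℝ (⊤ : ℕ∞) (fun p : ℝ × (EuclideanSpace ℝ (Fin 3)) => rotZ (-(ω * p.1)) p.2) :=
    contDiff_rotZ_comp ((contDiff_const.mul contDiff_fst).neg) contDiff_snd
  have h3 : ContDiff ℝ (⊤ : ℕ∞) (fun p : ℝ × (EuclideanSpace ℝ (Fin 3)) => V (rotZ (-(ω * p.1)) p.2)) := hV.comp h2
  have h5 : ContDiff ℝ (⊤ : ℕ∞) (fun p : ℝ × (EuclideanSpace ℝ (Fin 3)) => rotZ (ω * p.1) (V (rotZ (-(ω * p.1)) p.2))) :=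
    contDiff_rotZ_comp (contDiff_const.mul contDiff_fst) h3
  have hP5 : ContDiff ℝ (⊤ : ℕ∞) (fun p : ℝ × (EuclideanSpace ℝ (Fin 3)) => Q (rotZ (-(ω * p.1)) p.2)) := hQ.comp h2
  refine IsBackwardLeraySolutionOn.of_leray ?_ ?_ ?_ ?_
  · -- the velocity is jointly smooth
    show ContDiffOn ℝ (⊤ : ℕ∞) (fun p : ℝ × (EuclideanSpace ℝ (Fin 3)) => Rot (ω * p.1) (V (Rot (-(ω * p.1)) p.2)))
      (univ ×ˢ univ)
    have e : (fun p : ℝ × (EuclideanSpace ℝ (Fin 3)) => Rot (ω * p.1) (V (Rot (-(ω * p.1)) p.2))) =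
        fun p : ℝ × (EuclideanSpace ℝ (Fin 3)) => rotZ (ω * p.1) (V (rotZ (-(ω * p.1)) p.2)) := by
      funext p
      rw [hR, hR]
    rw [e]
    exact h5.contDiffOn
  · -- the pressure is jointly smooth
    show ContDiffOn ℝ (⊤ : ℕ∞) (fun p : ℝ × (EuclideanSpace ℝ (Fin 3)) => Q (Rot (-(ω * p.1)) p.2)) (univ ×ˢ univ)
    have e : (fun p : ℝ × (EuclideanSpace ℝ (Fin 3)) => Q (Rot (-(ω * p.1)) p.2)) =
        fun p : ℝ × (EuclideanSpace ℝ (Fin 3)) => Q (rotZ (-(ω * p.1)) p.2) := by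
      funext p
      rw [hR]
    rw [e]
    exact hP5.contDiffOn
  · -- Leray's momentum equation
    intro s _ y
    -- the time derivative of the rotating frame: `∂ₛU = ω R (J V − DV·J)(R⁻¹ y)`
    have hderiv : HasDerivAt (fun t => Rot (ω * t) (V (Rot (-(ω * t)) y)))
        (Rot (ω * s) (ω • (rotGen (V ((Rot (ω * s)).symm y)) -
          fderiv ℝ V ((Rot (ω * s)).symm y) (rotGen ((Rot (ω * s)).symm y))))) s := by
      have e : (fun t => Rot (ω * t) (V (Rot (-(ω * t)) y))) =
          fun t => rotZ (ω * t) (V (rotZ (-(ω * t)) y)) := by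
        funext t
        rw [hR, hR]
      rw [e]
      simp only [hsymm, hR]
      have hθ₁ : HasDerivAt (fun t : ℝ => ω * t) ω s := by
        simpa using (hasDerivAt_id s).const_mul ω
      have hθ₂ : HasDerivAt (fun t : ℝ => -(ω * t)) (-ω) s := hθ₁.neg
      have hzd : HasDerivAt (fun t => rotZ (-(ω * t)) y) ((-ω) • rotGen (rotZ (-(ω * s)) y)) s := by
        have h := hasDerivAt_rotZ_comp hθ₂ (hasDerivAt_const s y)
        refine h.congr_deriv ?_
        have h0 : rotZ (-(ω * s)) (0 : EuclideanSpace ℝ (Fin 3)) = 0 := by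
          ext i
          fin_cases i <;> simp
        rw [h0, zero_add]
      have hwd : HasDerivAt (fun t => V (rotZ (-(ω * t)) y))
          (fderiv ℝ V (rotZ (-(ω * s)) y) ((-ω) • rotGen (rotZ (-(ω * s)) y))) s :=
        (hVd _).hasFDerivAt.comp_hasDerivAt s hzd
      have hUd : HasDerivAt (fun t => rotZ (ω * t) (V (rotZ (-(ω * t)) y)))
          (rotZ (ω * s) (fderiv ℝ V (rotZ (-(ω * s)) y) ((-ω) • rotGen (rotZ (-(ω * s)) y))) +
            ω • rotGen (rotZ (ω * s) (V (rotZ (-(ω * s)) y)))) s :=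
        hasDerivAt_rotZ_comp hθ₁ hwd
      refine hUd.congr_deriv ?_
      rw [ContinuousLinearMap.map_smul]
      exact rotZ_neg_smul_add_smul_rotGen _ _ _ _
    have htd : timeDerivWithin univ (fun s y => Rot (ω * s) (V (Rot (-(ω * s)) y))) s y =
        Rot (ω * s) (ω • (rotGen (V ((Rot (ω * s)).symm y)) -
          fderiv ℝ V ((Rot (ω * s)).symm y) (rotGen ((Rot (ω * s)).symm y)))) := by
      rw [timeDerivWithin_eq_deriv isOpen_univ (mem_univ s)]
      exact hderiv.deriv
    have hz : Rot (-(ω * s)) y = (Rot (ω * s)).symm y := (hsymm _ _).symm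
    beta_reduce
    rw [htd, hUfun s, hPfun s, hz, fderiv_conj_linearIsometryEquiv,
      convect_conj_linearIsometryEquiv, gradient_comp_linearIsometryEquiv_symm,
      laplacian_conj_linearIsometryEquiv, one_smul]
    have key := hEq ((Rot (ω * s)).symm y)
    rw [cross_single_two_eq_rotGen, cross_single_two_eq_rotGen] at key
    rw [← key]
    simp only [map_add, LinearIsometryEquiv.map_smul, ContinuousLinearMap.coe_comp,
      Function.comp_apply]
    rfl
  · -- the slices are divergence free
    intro s _
    show VectorCalculus.IsDivFree (fun y => Rot (ω * s) (V (Rot (-(ω * s)) y)))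
    rw [hUfun s]
    exact hdiv.conj_linearIsometryEquiv _

end Summit.NavierStokesRegularity.NavierStokesRegularity.Theorems.CorkscrewProfile.Birth
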